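import Mathlib
import HarnessLib
import Summits.HubbardSuperconductivity.HubbardSuperconductivity.Theorems.KLProgrammeKLRegimeSplitBundleV7

/-!
# Route `KLProgramme` — child `KLRegimeCountertermV7 := CountertermP2 klPredsV7 klWindowC` (stmt-HubbardSuperconductivity-19664):
# the ANGULAR READING of the local part — what the G-objects see, and how grid control plus an angular modulus gives every angle
# (seat hubbard-kl-k3c3-p3, technique «implicit-function / monotonicity route for μ(n)»)

Three groups of model-free lemmas for the one-volume construction `CtOneVolume` (`…KLRegimeCountertermV7Volume`):

* §1 **What the G-extension reads.**  `klFrameExtG L μ f` (hence `klTwoLegPolyG`, `klFrameProjG`, the pieces `klTwoLegPieceG` and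
  every clause (E3a-G)/(E3b-G)/(E3c-G) built on them) depends on the angular profile `f` ONLY through its values at the lattice
  angles `momentumAngle L k` and through its angular mean (`klFrameExtG_congr`, `klFrameExtG_congr_set`).  This is the formal kernel of
  defect Δ18 (cell gate-hubbard-kl, STATUS 2026-08-26T17:08Z): the renormalisation predicate `RenormalisedAtF` and the conclusion of
  `CtOneVolume` quantify over EVERY real angle, so an angular modulus of the local part must be supplied by the two-leg slot.
* §2 **Grid + modulus ⇒ every angle.**  If `|f| ≤ A` on a `δ`-net `S` of angles and `f` is `Λ`-Lipschitz (resp. has `|f′| ≤ Λ`), then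
  `|f| ≤ A + Λ·δ` everywhere (`abs_le_of_net_of_lipschitz`, `abs_le_of_net_of_deriv`) — the child-2 side of the repair (E3g).
* §3 **The δμ component by monotonicity.**  The constant (angular-mean) component of the counterterm solves a SCALAR equation
  `m + M(m) = 0`; when `|M| ≤ a` on `[-a, a]` and `M` is continuous there is a root in `[-a, a]` (intermediate values, no contraction:
  `exists_root_add_of_abs_le`), and when `M` is `q`-Lipschitz with `q < 1` the map `m ↦ m + M m` is strictly monotone, the root is
  unique and STABLE under perturbations of `M` (`root_add_unique`, `abs_root_sub_root_le`) — the implicit-function / monotonicity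
  route for `μ(n)`, to be composed with the mean-free stage map.

Proofs only; nothing is asserted about the Hubbard model.  References: BGM 2006 [arXiv:cond-mat/0507686] §2.3–2.4 (the constant part
of `δε` is the chemical-potential flow); FST, CPAM 53 (2000) 1350 (the counterterm as a function on the Fermi surface);
HOME/hubbard-kl-k3c3-p3/DEFECT-ANGULAR.md.
-/

noncomputable section

namespace Summit.HubbardSuperconductivity.HubbardSuperconductivity.Theorems.KLRegimeSplit

set_option linter.dupNamespace false -- summit = problem name (single-conjunct summit), D-0017

open Real Set
open Literature.MathematicalPhysics.QuantumLattice Literature.Probability.LatticeModels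
open Summit.HubbardSuperconductivity.HubbardSuperconductivity.Theorems.KLProgrammeLegKernels

/-! ## §1 What the G-extension reads: lattice angles and the mean only -/

section Reads

variable (L : ℕ) [NeZero L]

/-- **The G-extension is blind off the lattice angles**: two angular profiles with the same values at every lattice angle
`momentumAngle L k` and the same angular mean have the SAME G-extension (as frames, not just as functions). -/
theorem klFrameExtG_congr (μ : ℝ) {f g : ℝ → ℝ} (hfg : ∀ k : TorusSite 2 L, f (momentumAngle L k) = g (momentumAngle L k))
    (hmean : klAngularMean f = klAngularMean g) : klFrameExtG L μ f = klFrameExtG L μ g := by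
  unfold klFrameExtG
  congr 1
  funext k
  rw [hfg k, hmean]

/-- Set form: profiles agreeing on the finite set of lattice angles `{momentumAngle L k}` and in mean have equal G-extensions —
whatever they do at the other (e.g. irrational-slope) angles. -/
theorem klFrameExtG_congr_set (μ : ℝ) {f g : ℝ → ℝ}
    (hfg : Set.EqOn f g (Set.range fun k : TorusSite 2 L => momentumAngle L k))
    (hmean : klAngularMean f = klAngularMean g) : klFrameExtG L μ f = klFrameExtG L μ g :=
  klFrameExtG_congr L μ (fun k => hfg ⟨k, rfl⟩) hmean

/-- In particular the VALUES of the G-extension at every continuum momentum are functions of the grid values and the mean. -/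
theorem eval_klFrameExtG_congr (μ : ℝ) {f g : ℝ → ℝ} (hfg : ∀ k : TorusSite 2 L, f (momentumAngle L k) = g (momentumAngle L k))
    (hmean : klAngularMean f = klAngularMean g) (p : Fin 2 → ℝ) :
    (klFrameExtG L μ f).eval p = (klFrameExtG L μ g).eval p := by
  rw [klFrameExtG_congr L μ hfg hmean]

end Reads

/-! ## §2 Grid control plus an angular modulus gives every angle -/

/-- **Net + Lipschitz ⇒ everywhere.**  If `|f a| ≤ A` at every point `a` of a set `S`, every `θ` is within `δ` of some point of `S`, and
`f` is `Λ`-Lipschitz in the form `|f x − f y| ≤ Λ·|x − y|`, then `|f θ| ≤ A + Λ·δ` for every `θ`. -/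
theorem abs_le_of_net_of_lipschitz {f : ℝ → ℝ} {S : Set ℝ} {A Λ δ : ℝ} (hΛ : 0 ≤ Λ)
    (hS : ∀ a ∈ S, |f a| ≤ A) (hnet : ∀ θ : ℝ, ∃ a ∈ S, |θ - a| ≤ δ)
    (hlip : ∀ x y : ℝ, |f x - f y| ≤ Λ * |x - y|) (θ : ℝ) : |f θ| ≤ A + Λ * δ := by
  obtain ⟨a, haS, ha⟩ := hnet θ
  have h1 : |f θ - f a| ≤ Λ * δ := (hlip θ a).trans (mul_le_mul_of_nonneg_left ha hΛ)
  have h2 : |f θ| ≤ |f a| + |f θ - f a| := by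
    have := abs_add_le (f a) (f θ - f a)
    simpa [add_sub_cancel] using this
  linarith [hS a haS]

/-- **Net + derivative bound ⇒ everywhere.**  If `|f a| ≤ A` on a `δ`-net `S`, `f` is differentiable with `|f′| ≤ Λ`, then
`|f θ| ≤ A + Λ·δ` everywhere (mean value inequality). -/
theorem abs_le_of_net_of_deriv {f : ℝ → ℝ} {S : Set ℝ} {A Λ δ : ℝ}
    (hS : ∀ a ∈ S, |f a| ≤ A) (hnet : ∀ θ : ℝ, ∃ a ∈ S, |θ - a| ≤ δ)
    (hdiff : Differentiable ℝ f) (hderiv : ∀ x : ℝ, |deriv f x| ≤ Λ) (θ : ℝ) : |f θ| ≤ A + Λ * δ := by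
  have hΛ : 0 ≤ Λ := (abs_nonneg _).trans (hderiv 0)
  refine abs_le_of_net_of_lipschitz hΛ hS hnet (fun x y => ?_) θ
  have hlipW : LipschitzWith (Real.toNNReal Λ) f := by
    refine lipschitzWith_of_nnnorm_deriv_le hdiff fun x => ?_
    have h := hderiv x
    rw [← Real.norm_eq_abs] at h
    exact_mod_cast (show ‖deriv f x‖₊ ≤ Real.toNNReal Λ from by
      rw [← NNReal.coe_le_coe, coe_nnnorm, Real.coe_toNNReal _ hΛ]; exact h)
  have := hlipW.dist_le_mul x y
  rw [Real.dist_eq, Real.dist_eq, Real.coe_toNNReal _ hΛ] at this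
  exact this

/-! ## §3 The δμ component: a scalar equation solved by monotonicity -/

/-- **A root without contraction.**  If `M` is continuous on `[-a, a]` and `|M m| ≤ a` there, then `m + M m = 0` for some
`m ∈ [-a, a]` (intermediate value theorem: the map is `≤ 0` at `-a` and `≥ 0` at `a`). -/
theorem exists_root_add_of_abs_le {M : ℝ → ℝ} {a : ℝ} (ha : 0 ≤ a) (hcont : ContinuousOn M (Icc (-a) a))
    (hM : ∀ m ∈ Icc (-a) a, |M m| ≤ a) : ∃ m ∈ Icc (-a) a, m + M m = 0 := by
  have hle : -a ≤ a := by linarith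
  have hΦ : ContinuousOn (fun m => m + M m) (Icc (-a) a) := continuousOn_id.add hcont
  have hlo : (-a) + M (-a) ≤ 0 := by
    have := (abs_le.mp (hM (-a) ⟨le_rfl, hle⟩)).2; linarith
  have hhi : 0 ≤ a + M a := by
    have := (abs_le.mp (hM a ⟨hle, le_rfl⟩)).1; linarith
  have hmem : (0 : ℝ) ∈ Icc ((-a) + M (-a)) (a + M a) := ⟨hlo, hhi⟩
  obtain ⟨m, hm, hm0⟩ := intermediate_value_Icc hle hΦ hmem
  exact ⟨m, hm, hm0⟩

/-- **Strict monotonicity of `m ↦ m + M m`** when `M` is `q`-Lipschitz with `q < 1`. -/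
theorem strictMono_add_of_lipschitz {M : ℝ → ℝ} {q : ℝ} (hq : q < 1) (hM : ∀ x y : ℝ, |M x - M y| ≤ q * |x - y|) :
    StrictMono fun m => m + M m := by
  intro x y hxy
  have hxy' : 0 < y - x := sub_pos.mpr hxy
  have h := hM y x
  rw [abs_of_pos hxy'] at h
  have h2 : -(q * (y - x)) ≤ M y - M x := (abs_le.mp h).1
  show x + M x < y + M y
  nlinarith

/-- **Uniqueness of the root** of `m + M m = c` under `q`-Lipschitz `M`, `q < 1`. -/
theorem root_add_unique {M : ℝ → ℝ} {q c : ℝ} (hq : q < 1) (hM : ∀ x y : ℝ, |M x - M y| ≤ q * |x - y|) {m m' : ℝ}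
    (hm : m + M m = c) (hm' : m' + M m' = c) : m = m' :=
  (strictMono_add_of_lipschitz hq hM).injective (hm.trans hm'.symm)

/-- **Stability of the root (implicit-function estimate).**  If `m + M m = c` and `m' + M' m' = c'` with `M` `q`-Lipschitz, `q < 1`,
then `|m − m'| ≤ (1 − q)⁻¹ · (|c − c'| + |M m' − M' m'|)`: the root moves by at most `(1−q)⁻¹` times the change of the data — the
constant piece of the counterterm at two volumes / two frames is compared through this, never through a contraction constant of the
full map. -/
theorem abs_root_sub_root_le {M M' : ℝ → ℝ} {q c c' : ℝ} (hq : q < 1) (hM : ∀ x y : ℝ, |M x - M y| ≤ q * |x - y|) {m m' : ℝ}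
    (hm : m + M m = c) (hm' : m' + M' m' = c') : |m - m'| ≤ (1 - q)⁻¹ * (|c - c'| + |M m' - M' m'|) := by
  have h1q : 0 < 1 - q := by linarith
  rw [le_inv_mul_iff₀' h1q]
  -- (m − m') = (c − c') − (M m − M m') − (M m' − M' m')
  have hid : m - m' = (c - c') - (M m - M m') - (M m' - M' m') := by linarith
  have hq' : |M m - M m'| ≤ q * |m - m'| := hM m m'
  have htri : |m - m'| ≤ |c - c'| + |M m - M m'| + |M m' - M' m'| := by
    rw [hid]
    have := abs_sub (c - c' - (M m - M m')) (M m' - M' m')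
    have := abs_sub (c - c') (M m - M m')
    linarith
  nlinarith [abs_nonneg (m - m'), abs_nonneg (c - c'), abs_nonneg (M m' - M' m')]

/-- **A-priori size of the root**: if `m + M m = 0` and `|M m| ≤ a` then `|m| ≤ a`. -/
theorem abs_root_le {M : ℝ → ℝ} {a m : ℝ} (hm : m + M m = 0) (hM : |M m| ≤ a) : |m| ≤ a := by
  have : m = -M m := by linarith
  rw [this, abs_neg]; exact hM

end Summit.HubbardSuperconductivity.HubbardSuperconductivity.Theorems.KLRegimeSplit

end
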